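import Summits.NavierStokesRegularity.NavierStokesRegularity.Theses.SymmetryModuliCount
import Summits.NavierStokesRegularity.NavierStokesRegularity.Theorems.ForcedSymmetry.Negative.WithoutOseen
import Literature.Analysis.FluidPDE.TypeIAncientMild

/-!
# Crux `ForcedSymmetry` (stmt-NavierStokesRegularity-4052), negative side: load-bearing clauses of the
# stubs of line `time-anchor-bootstrap`

Drefute (D-0016) findings on the stub set of `Cruxes/ForcedSymmetry/Lines/time-anchor-bootstrap.lean`
(gen 2: five registered stubs), as kernel-checked NEGATIVE lemmas.  Each `…Without…` proposition below is
the registered stub with its class hypothesis `IsTypeIAncientMild C u` (= H1 ∧ H2 ∧ H3 ∧ H4 C, the clauses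
of `MustSqueeze/Negative/WithoutOseen.lean`) replaced by the clauses named, the generator identity kept
byte-for-byte in the stub's written-out form; no statement of the route is asserted positively.

* STUB 4 `stub_rigidComotionVanishing` needs the Type-I clause H4:
  `rigidComotionVanishing_false_without_H4` — constants are KNSS-mild (H1–H3, `isKNSSMild_const`),
  are annihilated by `τ∂ₜ + a·∇` and are not zero.
* STUBS 2a/2b `stub_futureVertexLiouville{Irrotational,Rotated}` need the Oseen clause H3:
  `futureVertexLiouvilleIrrotational_false_without_H3`, `futureVertexLiouvilleRotated_false_without_H3`
  — the parasitic future-vertex soliton `para t x = (1 − t)^{-1/2} e₀` is smooth on `t < 1` (H1),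
  divergence free (H2), Type-I with `C = 1` (H4), is annihilated by the plain AND by the `e₀`-rotated
  scaling generator about the FUTURE vertex `(θ, x_c) = (1, 0)` (`σ = 1`, `A = 0` resp. `A = rot0 ≠ 0`),
  and does not vanish; the gauge H3 is exactly what removes it (`para_not_isTypeIAncientMild`, by
  `IsTypeIAncientMild.eq_zero_of_slice_const`).
* STUB 1 `stub_extendedForcedSymmetry` (hardest) needs H3 even in the EXTENDED algebra `⟨∂ₜ⟩ ⊕ sim(3)`:
  `extendedForcedSymmetry_false_without_H3` — the symmetry-free Gaussian witness `w` of
  `Negative/Witness.lean` has trivial stabiliser in the extended algebra as well (`w_rigid_ext`): the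
  clock `e^{t/2}` kills `σ`, and five point evaluations (`0, ±e₂, e₀, e₁`) of the polynomial defect kill
  `(a, A, τ)` — the new evaluation at `e₁` reads `−τ/2 = 0`.
* STUB 3 `stub_interiorVertexVanishing` is a pure calculus fact on `C¹` fields of the open slab (no
  single clause among H2, H3, H4 is load-bearing); nothing negative to record.
-/

noncomputable section
noncomputable section

set_option linter.dupNamespace false

namespace Summit.NavierStokesRegularity.NavierStokesRegularity.Theorems.ForcedSymmetry.Negative.TimeAnchorStubs

open MeasureTheory Set Filter Topology Function
open Literature.Analysis.FluidPDE
open Summit.NavierStokesRegularity.NavierStokesRegularity.Theses.SymmetryModuliCount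
open Summit.NavierStokesRegularity.NavierStokesRegularity.Theorems.MustSqueeze.Negative
open Summit.NavierStokesRegularity.NavierStokesRegularity.Theorems.ForcedSymmetry.Negative

/-- `ℝ³`. -/
abbrev E3 : Type := EuclideanSpace ℝ (Fin 3)

/-! ## The extended generator (verbatim from the line) -/

/-- The EXTENDED infinitesimal generator of `(a, σ, A, τ) ∈ ⟨∂ₜ⟩ ⊕ sim(3)` acting on `u`:
`∇u·(a + σx + Ax) + σu + (2σt + τ)∂ₜu − Au` (verbatim `TimeAnchorBootstrap.extGen`). -/
def extGen (u : ℝ → E3 → E3) (a : E3) (σ : ℝ) (A : E3 →L[ℝ] E3) (τ : ℝ) (t : ℝ) (x : E3) : E3 :=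
  fderiv ℝ (u t) x (a + σ • x + A x) + σ • u t x + (2 * σ * t + τ) • timeDeriv u t x - A (u t x)

/-- `extGen u a σ A τ = L_ξ u + τ ∂ₜu` with `L_ξ = simGen` the crux's generator. -/
theorem extGen_eq_simGen_add (u : ℝ → E3 → E3) (a : E3) (σ : ℝ) (A : E3 →L[ℝ] E3) (τ t : ℝ) (x : E3) :
    extGen u a σ A τ t x = simGen u a σ A t x + τ • timeDeriv u t x := by
  simp only [extGen, simGen, add_smul]
  abel

/-! ## Stub 4 without the Type-I clause H4 is false: constants are rigid co-movers -/

/-- `Sig.stub_rigidComotionVanishing` of the line with the class `IsTypeIAncientMild C u`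
(= H1 ∧ H2 ∧ H3 ∧ H4 C) replaced by H1 ∧ H2 ∧ H3 (Type-I rate dropped). -/
def RigidComotionVanishingWithoutH4 : Prop :=
  ∀ (u : ℝ → E3 → E3), H1 u → H2 u → H3 u →
    ∀ (a : E3) (A : E3 →L[ℝ] E3) (τ : ℝ), (∀ x, inner ℝ (A x) x = 0) → τ ≠ 0 →
      (∀ t < 0, ∀ x, fderiv ℝ (u t) x (a + A x) + τ • timeDeriv u t x - A (u t x) = 0) →
      ∀ t < 0, ∀ x, u t x = 0

/-- A constant field is annihilated by every rigid co-motion `τ∂ₜ + a·∇` (`A = 0`). -/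
theorem rigidGen_const (c a : E3) (τ t : ℝ) (x : E3) :
    fderiv ℝ ((fun (_ : ℝ) (_ : E3) => c) t) x (a + (0 : E3 →L[ℝ] E3) x) +
      τ • timeDeriv (fun (_ : ℝ) (_ : E3) => c) t x - (0 : E3 →L[ℝ] E3) ((fun (_ : ℝ) (_ : E3) => c) t x) = 0 := by
  simp [timeDeriv]

/-- **Stub 4 needs H4.** The constant field `e₀` satisfies H1, H2, H3 (`isKNSSMild_const`), is
annihilated by the pure time translation `∂ₜ` (`a = 0`, `A = 0`, `τ = 1`), and is not zero. -/
theorem rigidComotionVanishing_false_without_H4 : ¬ RigidComotionVanishingWithoutH4 := by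
  intro h
  have hc := h1_h2_h6_const e0
  have key := h (fun _ _ => e0) hc.1 hc.2.1 (isKNSSMild_const e0) 0 0 1 (fun x => by simp)
    one_ne_zero (fun t _ x => rigidGen_const e0 0 1 t x) (-1) (by norm_num) 0
  have : (e0 : E3) 0 = 0 := by rw [key]; rfl
  simp at this

/-! ## Stub 2 without the Oseen clause H3 is false: the parasitic future-vertex soliton -/

/-- The parasitic soliton about the FUTURE vertex `θ = 1`: `para t x = (1 − t)^{-1/2} e₀`
(KNSS 2009 §1: `u = b(t)`, `p = −b'(t)·x`). -/
def para (t : ℝ) (_x : E3) : E3 := (Real.sqrt (1 - t))⁻¹ • e0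

/-- `√(1 − t) > 0` for `t < 1`. -/
theorem sqrt_one_sub_pos {t : ℝ} (ht : t < 1) : 0 < Real.sqrt (1 - t) :=
  Real.sqrt_pos.2 (by linarith)

/-- H1: `para` is smooth on the slab `t < 0` (indeed on `t < 1`). -/
theorem para_h1 : H1 para := by
  have h1 : ContDiffOn ℝ (⊤ : ℕ∞) (fun p : ℝ × E3 => (1 : ℝ) - p.1) (Iio 0 ×ˢ univ) :=
    (contDiff_const.sub contDiff_fst).contDiffOn
  have hne : ∀ p ∈ Iio (0 : ℝ) ×ˢ (univ : Set E3), (1 : ℝ) - p.1 ≠ 0 := by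
    rintro ⟨t, x⟩ ⟨ht, -⟩
    simp only [mem_Iio] at ht
    show (1 : ℝ) - t ≠ 0
    linarith
  have h2 : ContDiffOn ℝ (⊤ : ℕ∞) (fun p : ℝ × E3 => Real.sqrt ((1 : ℝ) - p.1)) (Iio 0 ×ˢ univ) :=
    h1.sqrt hne
  have hne2 : ∀ p ∈ Iio (0 : ℝ) ×ˢ (univ : Set E3), Real.sqrt ((1 : ℝ) - p.1) ≠ 0 := by
    rintro ⟨t, x⟩ ⟨ht, -⟩
    simp only [mem_Iio] at ht
    exact (sqrt_one_sub_pos (by linarith)).ne'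
  exact (h2.inv hne2).smul contDiffOn_const

/-- H2: `para` is divergence free (its slices are constant). -/
theorem para_h2 : H2 para := fun t ht =>
  (h1_h2_h6_const ((Real.sqrt (1 - t))⁻¹ • e0)).2.1 t ht

/-- `‖para t x‖ = 1/√(1 − t)` for `t < 1`. -/
theorem norm_para (t : ℝ) (ht : t < 1) (x : E3) : ‖para t x‖ = (Real.sqrt (1 - t))⁻¹ := by
  rw [para, norm_smul, norm_inv, Real.norm_eq_abs, abs_of_pos (sqrt_one_sub_pos ht)]
  simp [e0]

/-- H4 with `C = 1`: `‖para t x‖ = 1/√(1−t) ≤ 1/√(−t)`. -/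
theorem para_h4 : H4 1 para := by
  intro t ht x
  rw [norm_para t (by linarith) x, one_div]
  exact inv_anti₀ (Real.sqrt_pos.2 (by linarith)) (Real.sqrt_le_sqrt (by linarith))

/-- `∂ₜ para = (1/(2√(1−t)))/(√(1−t))² · e₀` on `t < 1`. -/
theorem hasDerivAt_para (t : ℝ) (ht : t < 1) (x : E3) :
    HasDerivAt (fun s => para s x)
      ((-(-1 / (2 * Real.sqrt (1 - t))) / Real.sqrt (1 - t) ^ 2) • e0) t := by
  have h1 : HasDerivAt (fun s : ℝ => (1 : ℝ) - s) (-1) t := by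
    simpa using (hasDerivAt_id' t).const_sub (1 : ℝ)
  have h2 : HasDerivAt (fun s : ℝ => Real.sqrt ((1 : ℝ) - s)) (-1 / (2 * Real.sqrt (1 - t))) t :=
    h1.sqrt (by linarith)
  have h3 := h2.inv (sqrt_one_sub_pos ht).ne'
  exact h3.smul_const e0

/-- The two-sided time derivative `timeDeriv para` on `t < 1`. -/
theorem timeDeriv_para (t : ℝ) (ht : t < 1) (x : E3) :
    timeDeriv para t x = ((-(-1 / (2 * Real.sqrt (1 - t))) / Real.sqrt (1 - t) ^ 2)) • e0 :=
  (hasDerivAt_para t ht x).deriv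

/-- Slices of `para` are constant, so their Fréchet derivative vanishes. -/
theorem fderiv_para (t : ℝ) (x : E3) : fderiv ℝ (para t) x = 0 := by
  have : para t = fun _ : E3 => (Real.sqrt (1 - t))⁻¹ • e0 := rfl
  rw [this, fderiv_const_apply]

/-- **The parasitic soliton is self-similar about the future vertex `(1, 0)`**: on `t < 1` it is
annihilated by the plain scaling generator about `(θ, x_c) = (1, 0)` (`a = 0`, `σ = 1`), in the
written-out form of `stub_futureVertexLiouvilleIrrotational`. -/
theorem para_scalingGen (t : ℝ) (ht : t < 1) (x : E3) :
    fderiv ℝ (para t) x (0 + (1 : ℝ) • x) + (1 : ℝ) • para t x +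
      (2 * 1 * (t - 1)) • timeDeriv para t x = 0 := by
  have hs := sqrt_one_sub_pos ht
  have hs2 : Real.sqrt (1 - t) ^ 2 = 1 - t := Real.sq_sqrt (by linarith)
  rw [fderiv_para, timeDeriv_para t ht x]
  simp only [zero_apply, zero_add, one_smul, para, smul_smul, ← add_smul]
  rw [smul_eq_zero]
  left
  field_simp
  nlinarith [hs2]

/-- `rot0` (rotation generator about the `e₀`-axis) is skew. -/
theorem inner_rot0_self (x : E3) : inner ℝ (rot0 x) x = 0 := by
  rw [rot0_apply, inner_sub_left, inner_smul_left, inner_smul_left]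
  simp only [e2, e1, inner_single_one_left]
  simp
  ring

/-- `rot0 e₀ = 0` (the axis). -/
theorem rot0_e0 : rot0 e0 = 0 := by ext i; fin_cases i <;> simp

/-- `rot0 ≠ 0` (`rot0 e₁ = e₂`). -/
theorem rot0_ne_zero : rot0 ≠ 0 := by
  intro h
  have : (rot0 e1 : E3) 2 = 0 := by rw [h]; rfl
  simp at this

/-- The same soliton is ALSO annihilated by the `e₀`-ROTATED scaling generator about `(1, 0)`
(`a = 0`, `σ = 1`, `A = rot0 ≠ 0`: `rot0 e₀ = 0`), in the written-out form of
`stub_futureVertexLiouvilleRotated`. -/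
theorem para_rotScalingGen (t : ℝ) (ht : t < 1) (x : E3) :
    fderiv ℝ (para t) x (0 + (1 : ℝ) • x + rot0 x) + (1 : ℝ) • para t x +
      (2 * 1 * (t - 1)) • timeDeriv para t x - rot0 (para t x) = 0 := by
  have h0 : rot0 (para t x) = 0 := by rw [para, map_smul, rot0_e0, smul_zero]
  have h1 : fderiv ℝ (para t) x (0 + (1 : ℝ) • x + rot0 x) = fderiv ℝ (para t) x (0 + (1 : ℝ) • x) := by
    rw [fderiv_para]; rfl
  rw [h0, sub_zero, h1]
  exact para_scalingGen t ht x

/-- `stub_futureVertexLiouvilleIrrotational` of the line with the class `IsTypeIAncientMild C u`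
replaced by H1 ∧ H2 ∧ H4 C (the Oseen/KNSS mild clause H3 dropped). -/
def FutureVertexLiouvilleIrrotationalWithoutH3 : Prop :=
  ∀ (C : ℝ) (u : ℝ → E3 → E3), H1 u → H2 u → H4 C u →
    ∀ (a : E3) (σ θ : ℝ), σ ≠ 0 → 0 < θ →
      (∀ t < 0, ∀ x, fderiv ℝ (u t) x (a + σ • x) + σ • u t x +
        (2 * σ * (t - θ)) • timeDeriv u t x = 0) →
      ∀ t < 0, ∀ x, u t x = 0

/-- **Stub 2a needs H3.** Witness: `para`, `C = 1`, `(a, σ, θ) = (0, 1, 1)`; `para (−1) 0 = 2^{-1/2} e₀ ≠ 0`.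
The irrotational future-vertex Liouville is exactly as strong as the gauge at its last step (Tsai's
`q = ∞` theorem leaves the constant profiles, i.e. precisely these solitons). -/
theorem futureVertexLiouvilleIrrotational_false_without_H3 :
    ¬ FutureVertexLiouvilleIrrotationalWithoutH3 := by
  intro h
  have key := h 1 para para_h1 para_h2 para_h4 0 1 1 one_ne_zero one_pos
    (fun t ht x => para_scalingGen t (by linarith) x) (-1) (by norm_num) 0
  have hn := norm_para (-1) (by norm_num) 0
  rw [key, norm_zero] at hn
  exact (inv_pos.2 (sqrt_one_sub_pos (by norm_num : (-1 : ℝ) < 1))).ne' hn.symm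

/-- `stub_futureVertexLiouvilleRotated` of the line with the class `IsTypeIAncientMild C u` replaced
by H1 ∧ H2 ∧ H4 C (H3 dropped). -/
def FutureVertexLiouvilleRotatedWithoutH3 : Prop :=
  ∀ (C : ℝ) (u : ℝ → E3 → E3), H1 u → H2 u → H4 C u →
    ∀ (a : E3) (σ : ℝ) (A : E3 →L[ℝ] E3) (θ : ℝ), (∀ x, inner ℝ (A x) x = 0) → A ≠ 0 → σ ≠ 0 →
      0 < θ →
      (∀ t < 0, ∀ x, fderiv ℝ (u t) x (a + σ • x + A x) + σ • u t x +
        (2 * σ * (t - θ)) • timeDeriv u t x - A (u t x) = 0) →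
      ∀ t < 0, ∀ x, u t x = 0

/-- **Stub 2b needs H3 as well.** Same witness with the rotation `A = rot0` about its own direction
`e₀` (`(a, σ, A, θ) = (0, 1, rot0, 1)`): an axisymmetric parasitic soliton is rotated-self-similar at
every rotation rate. -/
theorem futureVertexLiouvilleRotated_false_without_H3 : ¬ FutureVertexLiouvilleRotatedWithoutH3 := by
  intro h
  have key := h 1 para para_h1 para_h2 para_h4 0 1 rot0 1 inner_rot0_self rot0_ne_zero one_ne_zero
    one_pos (fun t ht x => para_rotScalingGen t (by linarith) x) (-1) (by norm_num) 0
  have hn := norm_para (-1) (by norm_num) 0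
  rw [key, norm_zero] at hn
  exact (inv_pos.2 (sqrt_one_sub_pos (by norm_num : (-1 : ℝ) < 1))).ne' hn.symm

/-- The gauge honours the witness: `para` is NOT a Type-I KNSS-mild ancient field for any `C`
(its slices are constant and it is not zero; `IsTypeIAncientMild.eq_zero_of_slice_const`). -/
theorem para_not_isTypeIAncientMild (C : ℝ) : ¬ IsTypeIAncientMild C para := by
  intro h
  have key := h.eq_zero_of_slice_const (b := fun t => (Real.sqrt (1 - t))⁻¹ • e0)
    (fun t _ x => rfl) (t := -1) (by norm_num) 0
  have hn := norm_para (-1) (by norm_num) 0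
  rw [key, norm_zero] at hn
  exact (inv_pos.2 (sqrt_one_sub_pos (by norm_num : (-1 : ℝ) < 1))).ne' hn.symm


/-! ## Stub 1 without the Oseen clause H3 is false even in the extended algebra `⟨∂ₜ⟩ ⊕ sim(3)` -/

section Rigid

variable {a : E3} {σ : ℝ} {A : E3 →L[ℝ] E3} {τ : ℝ}

/-- The `t`-independent part of `e^{-t/2} · extGen w`: the crux's `core` plus the new slot `(τ/2) V`. -/
def coreExt (a : E3) (σ : ℝ) (A : E3 →L[ℝ] E3) (τ : ℝ) (x : E3) : E3 :=
  core a σ A x + (τ / 2) • V x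

/-- `extGen w (t,x) = e^{t/2} (coreExt(x) + σ t V x)` (`∂ₜ w = w/2`). -/
theorem extGen_w (a : E3) (σ : ℝ) (A : E3 →L[ℝ] E3) (τ t : ℝ) (x : E3) :
    extGen w a σ A τ t x = Real.exp (t / 2) • (coreExt a σ A τ x + (σ * t) • V x) := by
  rw [extGen_eq_simGen_add, simGen_w, timeDeriv_w, coreExt]
  module

/-- `P e₁ = −e₀`. -/
theorem P_e1 : P e1 = -e0 := by ext i; fin_cases i <;> simp [P]

/-- `⟪e₁, v⟫ = v₁`. -/
@[simp] theorem inner_e1_left (v : E3) : inner ℝ e1 v = v 1 := inner_single_one_left 1 v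

/-- Step 1: the scaling component vanishes (slices `t = -1, -2` at `x = e₀`). -/
theorem sigma_eq_zero_ext (h : ∀ t < 0, ∀ x, extGen w a σ A τ t x = 0) : σ = 0 := by
  have h1 := h (-1) (by norm_num) e0
  have h2 := h (-2) (by norm_num) e0
  rw [extGen_w] at h1 h2
  have h1' := (smul_eq_zero.1 h1).resolve_left (Real.exp_pos _).ne'
  have h2' := (smul_eq_zero.1 h2).resolve_left (Real.exp_pos _).ne'
  have key : σ • V e0 = (coreExt a σ A τ e0 + (σ * (-1 : ℝ)) • V e0) -
      (coreExt a σ A τ e0 + (σ * (-2 : ℝ)) • V e0) := by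
    module
  rw [h1', h2', sub_zero, V_e0, smul_smul] at key
  have h3 := (smul_eq_zero.1 key).resolve_right e1_ne_zero
  exact (mul_eq_zero.1 h3).resolve_right (gauss_pos e0).ne'

/-- The reduced (Gaussian-free, polynomial) defect at `σ = 0` in the extended algebra:
`R a A x + (τ/2) P x`. -/
def RExt (a : E3) (A : E3 →L[ℝ] E3) (τ : ℝ) (x : E3) : E3 :=
  R a A x + (τ / 2) • P x

/-- At `σ = 0` the extended defect factors through the Gaussian. -/
theorem coreExt_zero_sigma (a : E3) (A : E3 →L[ℝ] E3) (τ : ℝ) (x : E3) :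
    coreExt a 0 A τ x = gauss x • RExt a A τ x := by
  rw [coreExt, core_zero_sigma, RExt, V]
  module

/-- Step 2: with `σ = 0`, the reduced extended defect vanishes everywhere. -/
theorem RExt_eq_zero (h : ∀ t < 0, ∀ x, extGen w a σ A τ t x = 0) (x : E3) : RExt a A τ x = 0 := by
  have hσ := sigma_eq_zero_ext h
  have h1 := h (-1) (by norm_num) x
  rw [extGen_w, hσ, zero_mul, zero_smul, add_zero, coreExt_zero_sigma] at h1
  have h1' := (smul_eq_zero.1 h1).resolve_left (Real.exp_pos _).ne'
  exact (smul_eq_zero.1 h1').resolve_left (gauss_pos x).ne'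

/-- Step 3: all thirteen coordinates of `(a, A e₀, A e₁, A e₂, τ)` vanish — the crux's four
evaluations at `0, e₂, −e₂, e₀` plus ONE new evaluation at `e₁`, whose first coordinate reads
`−τ/2 = 0` once `a = 0` and `A e₀ = 0` are known. -/
theorem coords_eq_zero_ext (hA : ∀ x, inner ℝ (A x) x = 0)
    (h : ∀ t < 0, ∀ x, extGen w a σ A τ t x = 0) :
    (a 0 = 0 ∧ a 1 = 0 ∧ a 2 = 0) ∧ (A e0 0 = 0 ∧ A e0 1 = 0 ∧ A e0 2 = 0) ∧
      (A e1 0 = 0 ∧ A e1 1 = 0 ∧ A e1 2 = 0) ∧ (A e2 0 = 0 ∧ A e2 1 = 0 ∧ A e2 2 = 0) ∧ τ = 0 := by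
  -- skewness
  have d0 : A e0 0 = 0 := skew_diag hA 0
  have d1 : A e1 1 = 0 := skew_diag hA 1
  have d2 : A e2 2 = 0 := skew_diag hA 2
  have o01 : A e1 0 = - A e0 1 := skew_off hA 0 1
  have o02 : A e2 0 = - A e0 2 := skew_off hA 0 2
  have o12 : A e2 1 = - A e1 2 := skew_off hA 1 2
  -- the reduced defect at 0, e₂, -e₂, e₀, e₁
  have r0 := RExt_eq_zero h 0
  have r2 := RExt_eq_zero h e2
  have r2' := RExt_eq_zero h (-e2)
  have r1 := RExt_eq_zero h e0
  have r3 := RExt_eq_zero h e1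
  simp only [RExt, R, map_zero, add_zero, P_zero, smul_zero, sub_zero, P_e2, P_neg_e2, map_neg, P_e0,
    P_e1, smul_neg] at r0 r2 r2' r1 r3
  have c00 := congrArg (fun v : E3 => v 0) r0
  have c01 := congrArg (fun v : E3 => v 1) r0
  have c20 := congrArg (fun v : E3 => v 0) r2
  have c2'1 := congrArg (fun v : E3 => v 1) r2'
  have c11 := congrArg (fun v : E3 => v 1) r1
  have c12 := congrArg (fun v : E3 => v 2) r1
  have c30 := congrArg (fun v : E3 => v 0) r3
  simp only [DP_c0, DP_c1, DP_c2, PiLp.add_apply, PiLp.sub_apply, PiLp.neg_apply, PiLp.smul_apply,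
    PiLp.zero_apply, smul_eq_mul, e0_c0, e0_c1, e0_c2, e1_c1, e1_c2, e2_c0, e2_c2,
    inner_e0_left, inner_e1_left] at c00 c01 c20 c2'1 c11 c12 c30
  have ha1 : a 1 = 0 := by linarith
  have ha0 : a 0 = 0 := by linarith
  have h21 : A e2 1 = 0 := by linarith
  have h20 : A e2 0 = 0 := by linarith
  have h02 : A e0 2 = 0 := by linarith
  have h12 : A e1 2 = 0 := by linarith
  have h01 : A e0 1 = 0 := by linarith
  have h10 : A e1 0 = 0 := by linarith
  have hτ : τ = 0 := by linarith
  have ha2 : a 2 = 0 := by linarith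
  exact ⟨⟨ha0, ha1, ha2⟩, ⟨d0, h01, h02⟩, ⟨h10, d1, h12⟩, ⟨h20, h21, d2⟩, hτ⟩

/-- **Rigidity of the witness in the extended algebra**: `extGen w (a, σ, A, τ) ≡ 0` on `t < 0` with
`A` skew forces `(a, σ, A, τ) = 0`. -/
theorem w_rigid_ext (hA : ∀ x, inner ℝ (A x) x = 0) (h : ∀ t < 0, ∀ x, extGen w a σ A τ t x = 0) :
    a = 0 ∧ σ = 0 ∧ A = 0 ∧ τ = 0 := by
  obtain ⟨⟨ha0, ha1, ha2⟩, ⟨h00, h01, h02⟩, ⟨h10, h11, h12⟩, ⟨h20, h21, h22⟩, hτ⟩ :=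
    coords_eq_zero_ext hA h
  refine ⟨?_, sigma_eq_zero_ext h, ?_, hτ⟩
  · ext i; fin_cases i <;> simp [ha0, ha1, ha2]
  · have hA0 : A e0 = 0 := by ext i; fin_cases i <;> simp [h00, h01, h02]
    have hA1 : A e1 = 0 := by ext i; fin_cases i <;> simp [h10, h11, h12]
    have hA2 : A e2 = 0 := by ext i; fin_cases i <;> simp [h20, h21, h22]
    refine ContinuousLinearMap.coe_inj.1 ((EuclideanSpace.basisFun (Fin 3) ℝ).toBasis.ext fun i => ?_)
    fin_cases i
    · simpa [e0] using hA0
    · simpa [e1] using hA1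
    · simpa [e2] using hA2

end Rigid

/-- `Sig.stub_extendedForcedSymmetry` of the line with the class `IsTypeIAncientMild C u` replaced by
H1 ∧ H2 ∧ H4 C (the Oseen/KNSS mild clause H3 dropped): the "kinematic" extended forced symmetry. -/
def ExtendedForcedSymmetryWithoutH3 : Prop :=
  ∀ (C : ℝ) (u : ℝ → E3 → E3), H1 u → H2 u → H4 C u →
    ∃ (a : E3) (σ : ℝ) (A : E3 →L[ℝ] E3) (τ : ℝ), (∀ x, inner ℝ (A x) x = 0) ∧
      ¬ (a = 0 ∧ σ = 0 ∧ A = 0 ∧ τ = 0) ∧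
        ∀ t < 0, ∀ x, fderiv ℝ (u t) x (a + σ • x + A x) + σ • u t x +
          (2 * σ * t + τ) • timeDeriv u t x - A (u t x) = 0

/-- **Stub 1 needs H3, even with the eighth generator `∂ₜ`.** With H3 deleted the extended forced
symmetry is FALSE: the Gaussian witness `w t x = e^{t/2} e^{−‖x‖²}(rot x + x₀ rot0 x)` (H1, H2, H4 with
`C = 2`) is not a steady state / travelling or rotating wave, not Killing-symmetric and not an exact
(rotated) scaling soliton about ANY space–time vertex (`w_rigid_ext`). So the re-anchoring of the crux
(time translations, past/future vertices) does not weaken it to a kinematic statement: any engine for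
stub 1 must use the Oseen identity of `u` itself. -/
theorem extendedForcedSymmetry_false_without_H3 : ¬ ExtendedForcedSymmetryWithoutH3 := by
  intro h
  obtain ⟨a, σ, A, τ, hA, hne, hL⟩ := h 2 w w_h1 w_h2 w_h4
  exact hne (w_rigid_ext hA fun t ht x => hL t ht x)

end Summit.NavierStokesRegularity.NavierStokesRegularity.Theorems.ForcedSymmetry.Negative.TimeAnchorStubs

end
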